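import Summits.AtomisticToContinuum.HydrodynamicLimit.Theorems.EnskogAdjointDualityAdjointEnskogTestFamilyROperatorKappaOnePrep2
import Summits.AtomisticToContinuum.HydrodynamicLimit.Theorems.EnskogAdjointDualityAdjointEnskogTestFamilyROperatorKappaOnePrep3
import Summits.AtomisticToContinuum.HydrodynamicLimit.Theorems.EnskogAdjointDualityAdjointEnskogTestFamilyROperatorKappaOnePrep4
import Summits.AtomisticToContinuum.HydrodynamicLimit.Theorems.EnskogAdjointDualityAdjointEnskogTestFamilyRKernelDipole
import HarnessLib

/-!
# K2R refutation, stub `operatorKappaOne`: identity (I) for the corrector part of the test function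

Route `EnskogAdjointDuality` of `AtomisticToContinuum/HydrodynamicLimit`, crux K2R `AdjointEnskogTestFamilyR`
(stmt-AtomisticToContinuum-11592), line `refutation`, registered stub `stub_operatorKappaOne`.

Testing the defect inequality of an admissible family at a constant background (`Y₀`, `ρ₀`, Maxwellian
`M`) against `ζ(s) sin(2πx₀) Θ₁^R(v)` with the dipole weight `Θ₁^R(v) = |v|(1+|v|²)⁻⁴e^{-|v|²/R} v₀`
produces, on the corrector part `κ` of the test function, `z ∫∫ Θ₁ sin(2πx₀) L_κ` (`z = ζ(s)`), where
`L_κ(x, v) = ∫∫ q₊ Y₀ ρ₀ M [κ(x,v') + κ(x⁺,w') − κ(x,v) − κ(x⁺,w)]`, `x⁺ = x + εω`.  We prove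
`z ∫∫ Θ₁ sin L_κ = −z (π/5) Y₀ρ₀ 𝔨₀ + O(|z|)`, `𝔨₀ = ∫∫ Θ₀ v₀ sin(2πx₀) κ`, with the `R`-growth of the
error confined to `Y₀ρ₀ C 32π² (k + k²/2) J_R`, `k = 2πε`, `J_R = ∫₀^∞ E²(1+E)⁻³e^{-E/R}`:
1. integrate out `x` first (`k2r_ref_ok1_x_integral`): with the torus averages `κ_s, κ_c` of `κ` against
   `sin, cos(2πx₀)`, `∫ sin L_κ dx = Y₀ρ₀ (G₁ + G₂ − ν κ_s − G₄)` is the bracket of `stub_kappaOperator` for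
   `(κ_s, g₂)`, `g₂(ω, U) = cos(kω₀)κ_s(U) − sin(kω₀)κ_c(U)`;
2. the two gain terms are moved onto the explicit dual kernel `I₁^R` (`k2r_ref_ok1_triple1`) and the
   sphere integral is split as `1 + cos(kω₀) = 2 + (cos(kω₀) − 1)`: the `cos − 1` and `sin` parts are
   `O((k²/2 + k) C B)` with `B = ∫_{S²}∫(1+|U|²)I₀^R ≤ 32π²J_R + 1760π` (`k2r_ref_ok1_B_le`);
3. the isotropic part `2∫ κ_s ∫I₁ dσ − ∫ Θ₁ ν κ_s` contracts onto `−(π/5) ∫ Θ₀ U₀ κ_s = −(π/5)𝔨₀` up to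
   `C(πM₁ + 4π)` (`k2r_ref_ok1_contraction`, kernel estimate K1 `stub_kernelDipole`, zonal reduction
   `stub_kernelBridge`);
4. the exchange term is `O(2080πC)` (`k2r_ref_ok1_exchange_bound`).

References: C. Cercignani, R. Illner, M. Pulvirenti, *The Mathematical Theory of Dilute Gases* (1994),
§3.1, §7.2 [CIP1994].
-/

noncomputable section

open MeasureTheory Set Filter Function
open scoped InnerProductSpace Real

namespace Summit.AtomisticToContinuum.HydrodynamicLimit.Theorems.EnskogAdjointDuality

open Literature.MathematicalPhysics.KineticTheory Literature.Analysis.FluidPDE Literature.Analysis.FunctionSpaces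
open Literature.Analysis.UnboundedOperators (collisionFrequency)

/-- Final arithmetic of the assembly. [folklore] -/
theorem k2r_ref_ok1_arith {z z' A C k B M₁ Mp J Ecw Esw Ctr T4 : ℝ} (hA : 0 < A) (hC : 0 ≤ C) (hk : 0 ≤ k)
    (hJ : 0 ≤ J) (hB : B ≤ 32 * Real.pi ^ 2 * J + 1760 * Real.pi) (hMp : M₁ ≤ Mp) (hMp0 : 0 ≤ Mp)
    (hcw : |Ecw| ≤ k ^ 2 / 2 * C * B) (hsw : |Esw| ≤ k * C * B) (hctr : |Ctr| ≤ C * (Real.pi * M₁ + 4 * Real.pi))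
    (hT4 : |T4| ≤ 2080 * Real.pi * C) :
    |z * A * (Ctr + Ecw - Esw - T4)| ≤ (|z| + |z'|) * (A * C * ((k + k ^ 2 / 2) * (1760 * Real.pi) +
      Real.pi * Mp + 2084 * Real.pi) + A * C * (32 * Real.pi ^ 2) * (k + k ^ 2 / 2) * J) := by
  have h1 : |Ctr + Ecw - Esw - T4| ≤ C * (Real.pi * M₁ + 4 * Real.pi) + k ^ 2 / 2 * C * B + k * C * B +
      2080 * Real.pi * C := by
    have := abs_sub (Ctr + Ecw - Esw) T4
    have := abs_sub (Ctr + Ecw) Esw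
    have := abs_add_le Ctr Ecw
    linarith
  have h2 : C * (Real.pi * M₁ + 4 * Real.pi) + k ^ 2 / 2 * C * B + k * C * B + 2080 * Real.pi * C ≤
      C * ((k + k ^ 2 / 2) * (1760 * Real.pi) + Real.pi * Mp + 2084 * Real.pi) + C * (32 * Real.pi ^ 2) * (k + k ^ 2 / 2) * J := by
    have hkk : 0 ≤ k + k ^ 2 / 2 := by positivity
    nlinarith [mul_le_mul_of_nonneg_left hB (mul_nonneg hkk hC), mul_le_mul_of_nonneg_left hMp (mul_nonneg Real.pi_pos.le hC),
      Real.pi_pos]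
  rw [abs_mul, abs_mul, abs_of_pos hA]
  have hz' : 0 ≤ |z'| := abs_nonneg _
  have hR : 0 ≤ A * C * ((k + k ^ 2 / 2) * (1760 * Real.pi) + Real.pi * Mp + 2084 * Real.pi) +
      A * C * (32 * Real.pi ^ 2) * (k + k ^ 2 / 2) * J := by positivity
  calc |z| * A * |Ctr + Ecw - Esw - T4|
      ≤ |z| * A * (C * ((k + k ^ 2 / 2) * (1760 * Real.pi) + Real.pi * Mp + 2084 * Real.pi) +
          C * (32 * Real.pi ^ 2) * (k + k ^ 2 / 2) * J) := by gcongr; exact h1.trans h2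
    _ = |z| * (A * C * ((k + k ^ 2 / 2) * (1760 * Real.pi) + Real.pi * Mp + 2084 * Real.pi) +
          A * C * (32 * Real.pi ^ 2) * (k + k ^ 2 / 2) * J) := by ring
    _ ≤ _ := by nlinarith

/-- **Registered stub `stub_operatorKappaOne`** (line `refutation` of crux K2R
`Summit.AtomisticToContinuum.HydrodynamicLimit.Theses.EnskogAdjointDuality.AdjointEnskogTestFamilyR`):
identity (I) for the corrector part of the test function — product integrability on `𝕋³ × ℝ³` of
`Θ₁^R · z sin(2πx₀) · L_κ`, and `∫∫ Θ₁^R z sin(2πx₀) L_κ = −z (π/5) Y₀ρ₀ 𝔨₀ + O(|z|)` with the `R`-growth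
of the error confined to `Y₀ρ₀ C 32π² (k + k²/2) J_R` — verbatim registered signature.
[cite: CIP1994, §3.1] -/
theorem stub_operatorKappaOne :
  ∀ (Y₀ ρ₀ ε lam C : ℝ), 0 < Y₀ → 0 < ρ₀ → 0 < ε → 2 * Real.pi * ε ≤ Real.pi / 2 → 0 < lam → 0 ≤ C →
  ∃ Bdd : ℝ, ∀ (cc : UnitAddTorus (Fin 3) → ℝ × EuclideanSpace ℝ (Fin 3) × ℝ) (κ : UnitAddTorus (Fin 3) → EuclideanSpace ℝ (Fin 3) → ℝ),
    Continuous cc → Continuous (Function.uncurry κ) → (∀ x, ‖cc x‖ ≤ C) →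
    (∀ x y, dist (cc x) (cc y) ≤ C * dist x y) → (∀ x v, |κ x v| ≤ C * (1 + ‖v‖ ^ 2)) →
    ∀ (Lκ : UnitAddTorus (Fin 3) → EuclideanSpace ℝ (Fin 3) → ℝ), (∀ x v, Lκ x v = ∫ ω : Metric.sphere (0 : EuclideanSpace ℝ (Fin 3)) 1, (∫ w : EuclideanSpace ℝ (Fin 3),
        max (inner ℝ (v - w) (ω : EuclideanSpace ℝ (Fin 3))) 0 * Y₀ * (ρ₀ * globalMaxwellian w) *
          (κ x (v - inner ℝ (v - w) (ω : EuclideanSpace ℝ (Fin 3)) • (ω : EuclideanSpace ℝ (Fin 3))) + κ (x + Torus.proj (ε • (ω : EuclideanSpace ℝ (Fin 3)))) (w + inner ℝ (v - w) (ω : EuclideanSpace ℝ (Fin 3)) • (ω : EuclideanSpace ℝ (Fin 3))) - κ x v - κ (x + Torus.proj (ε • (ω : EuclideanSpace ℝ (Fin 3)))) w)) ∂sphereMeasure) →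
    ∀ R : ℝ, 1 ≤ R → ∀ z z' : ℝ,
    Integrable (fun p : UnitAddTorus (Fin 3) × EuclideanSpace ℝ (Fin 3) => (Real.sqrt (‖p.2‖ ^ 2) * ((1 + ‖p.2‖ ^ 2) ^ 4)⁻¹ * Real.exp (-‖p.2‖ ^ 2 / R) * p.2 0) * ((z * Torus.sinCoord 0 p.1) * Lκ p.1 p.2)) (volume.prod volume) ∧
    |(∫ x : UnitAddTorus (Fin 3), ∫ v : EuclideanSpace ℝ (Fin 3), (Real.sqrt (‖v‖ ^ 2) * ((1 + ‖v‖ ^ 2) ^ 4)⁻¹ * Real.exp (-‖v‖ ^ 2 / R) * v 0) * ((z * Torus.sinCoord 0 x) * Lκ x v)) -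
        (-(z * (Real.pi / 5 * (Y₀ * ρ₀)) * (∫ x : UnitAddTorus (Fin 3), ∫ v : EuclideanSpace ℝ (Fin 3), ((1 + ‖v‖ ^ 2) ^ 3)⁻¹ * Real.exp (-‖v‖ ^ 2 / R) * v 0 * Torus.sinCoord 0 x * κ x v)))| ≤
      (|z| + |z'|) * (Bdd + Y₀ * ρ₀ * C * (32 * Real.pi ^ 2) *
        ((2 * Real.pi * ε) + (2 * Real.pi * ε) ^ 2 / 2) * (∫ E in Set.Ioi (0 : ℝ), E ^ 2 * (((1 + E) ^ 3)⁻¹ * Real.exp (-E / R)))) := by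
  intro Y₀ ρ₀ ε lam C hY₀ hρ₀ hε hk _ hC
  haveI := isFiniteMeasure_sphereMeasure (E := V3)
  -- the pinned objects of the preparation files
  obtain ⟨Θ₀, hΘ₀⟩ : ∃ Θ₀ : ℝ → V3 → ℝ, ∀ R v, Θ₀ R v = ((1 + ‖v‖ ^ 2) ^ 3)⁻¹ * Real.exp (-‖v‖ ^ 2 / R) :=
    ⟨_, fun _ _ => rfl⟩
  obtain ⟨Θ₁, hΘ₁⟩ : ∃ Θ₁ : ℝ → V3 → ℝ, ∀ R v, Θ₁ R v =
      Real.sqrt (‖v‖ ^ 2) * ((1 + ‖v‖ ^ 2) ^ 4)⁻¹ * Real.exp (-‖v‖ ^ 2 / R) * v 0 := ⟨_, fun _ _ => rfl⟩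
  obtain ⟨I₀, hI₀⟩ : ∃ I₀ : ℝ → V3 → V3 → ℝ, ∀ R U n, I₀ R U n =
      (1 / 2 : ℝ) * Real.exp (-(‖U‖ ^ 2 - ⟪U, n⟫_ℝ ^ 2) / 2) *
        (∫ b, max (⟪U, n⟫_ℝ - b) 0 * (Real.exp (-b ^ 2 / 2) / Real.sqrt (2 * π))) *
        ∫ E in Ioi (⟪U, n⟫_ℝ ^ 2), ((1 + E) ^ 3)⁻¹ * Real.exp (-E / R) := ⟨_, fun _ _ _ => rfl⟩
  obtain ⟨I₁, hI₁⟩ : ∃ I₁ : ℝ → V3 → V3 → ℝ, ∀ R U n, I₁ R U n =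
      n 0 * ⟪U, n⟫_ℝ * ((1 / 2 : ℝ) * Real.exp (-(‖U‖ ^ 2 - ⟪U, n⟫_ℝ ^ 2) / 2) *
        (∫ b, max (⟪U, n⟫_ℝ - b) 0 * (Real.exp (-b ^ 2 / 2) / Real.sqrt (2 * π))) *
        ∫ E in Ioi (⟪U, n⟫_ℝ ^ 2), Real.sqrt E * ((1 + E) ^ 4)⁻¹ * Real.exp (-E / R)) := ⟨_, fun _ _ _ => rfl⟩
  -- the kernel estimate (K1) with the half-Gaussian moment `h` and the radial loss profile `n(u) = ν(u e₀)`
  obtain ⟨⟨hhc, -, -⟩, hhb, -, -, -, hcf⟩ := stub_halfGaussian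
  have hcfm := Literature.Analysis.UnboundedOperators.measurable_collisionFrequency (E := V3)
  have he0 : ‖(EuclideanSpace.single 0 1 : V3)‖ = 1 := by simp
  obtain ⟨M₁, hM₁⟩ := stub_kernelDipole
    (fun a : ℝ => ∫ b, max (a - b) 0 * (Real.exp (-b ^ 2 / 2) / Real.sqrt (2 * Real.pi))) hhc
    (fun a => ⟨(hhb a).1, (hhb a).2.1⟩) (fun a => (hhb a).2.2)
    (fun u : ℝ => collisionFrequency (u • (EuclideanSpace.single 0 1 : V3)))
    (hcfm.comp (by fun_prop)) (fun u hu => by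
      obtain ⟨h1, h2, -⟩ := hcf (u • (EuclideanSpace.single 0 1 : V3))
      have hn : ‖u • (EuclideanSpace.single 0 1 : V3)‖ = u := by
        rw [norm_smul, he0, mul_one, Real.norm_of_nonneg hu]
      rw [hn] at h1 h2
      exact ⟨h1, h2⟩)
  refine ⟨Y₀ * ρ₀ * C * (((2 * Real.pi * ε) + (2 * Real.pi * ε) ^ 2 / 2) * (1760 * Real.pi) +
    Real.pi * max M₁ 0 + 2084 * Real.pi), ?_⟩
  intro cc κ _ hκ _ _ hκb Lκ hLκ R hR z z'
  have hR0 : 0 < R := by linarith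
  have hk0 : 0 ≤ 2 * Real.pi * ε := by positivity
  -- the torus averages of the corrector
  have hsin : Continuous (Torus.sinCoord (0 : Fin 3) : UnitAddTorus (Fin 3) → ℝ) := (Torus.isSmooth_sinCoord 0).continuous
  have hcos : Continuous (Torus.cosCoord (0 : Fin 3) : UnitAddTorus (Fin 3) → ℝ) := (Torus.isSmooth_cosCoord 0).continuous
  have hsin1 : ∀ x : UnitAddTorus (Fin 3), |Torus.sinCoord 0 x| ≤ 1 := fun x => by
    obtain ⟨t, ht⟩ := Torus.exists_coe_eq (x 0)
    rw [Torus.sinCoord_of_eq ht.symm]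
    exact Real.abs_sin_le_one _
  obtain ⟨κs, hκs⟩ : ∃ κs : V3 → ℝ, ∀ U, κs U = ∫ x : UnitAddTorus (Fin 3), Torus.sinCoord 0 x * κ x U := ⟨_, fun _ => rfl⟩
  obtain ⟨κc, hκc⟩ : ∃ κc : V3 → ℝ, ∀ U, κc U = ∫ x : UnitAddTorus (Fin 3), Torus.cosCoord 0 x * κ x U := ⟨_, fun _ => rfl⟩
  obtain ⟨hκsc, hκsb⟩ := k2r_ref_ok1_avg hκ hκb hsin hsin1 hκs
  obtain ⟨hκcc, hκcb⟩ := k2r_ref_ok1_avg hκ hκb hcos (Torus.abs_cosCoord_le 0) hκc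
  -- (i) product integrability
  have hInt := k2r_ref_ok1_prod_integrable hρ₀.le hκ hκb Lκ hLκ hR z
  refine ⟨hInt, ?_⟩
  -- the delocalised pair `g₂(ω, U) = cos(kω₀) κ_s(U) − sin(kω₀) κ_c(U)`
  have hco : Continuous fun ω : Metric.sphere (0 : V3) 1 => (ω : V3) 0 := by fun_prop
  have hK2c : Continuous fun p : Metric.sphere (0 : V3) 1 × V3 =>
      Real.cos (2 * Real.pi * ε * (p.1 : V3) 0) * κs p.2 - Real.sin (2 * Real.pi * ε * (p.1 : V3) 0) * κc p.2 := by
    fun_prop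
  have hC2 : 0 ≤ 2 * C := by positivity
  have hK2b : ∀ p : Metric.sphere (0 : V3) 1 × V3,
      |Real.cos (2 * Real.pi * ε * (p.1 : V3) 0) * κs p.2 - Real.sin (2 * Real.pi * ε * (p.1 : V3) 0) * κc p.2| ≤
        2 * C * (1 + ‖p.2‖ ^ 2) := fun p => by
    have h1 : |Real.cos (2 * Real.pi * ε * (p.1 : V3) 0) * κs p.2| ≤ C * (1 + ‖p.2‖ ^ 2) := by
      rw [abs_mul]
      exact (mul_le_mul (Real.abs_cos_le_one _) (hκsb p.2) (abs_nonneg _) zero_le_one).trans (by rw [one_mul])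
    have h2 : |Real.sin (2 * Real.pi * ε * (p.1 : V3) 0) * κc p.2| ≤ C * (1 + ‖p.2‖ ^ 2) := by
      rw [abs_mul]
      exact (mul_le_mul (Real.abs_sin_le_one _) (hκcb p.2) (abs_nonneg _) zero_le_one).trans (by rw [one_mul])
    exact (abs_sub _ _).trans (by linarith)
  have hK1b : ∀ p : Metric.sphere (0 : V3) 1 × V3, |κs p.2| ≤ C * (1 + ‖p.2‖ ^ 2) := fun p => hκsb p.2
  -- the four pieces of `∫ sin L_κ dx` against `Θ₁` (clean restatements of the preparation lemmas)
  have hT1 := k2r_ref_ok1_triple1 hΘ₁ hI₁ hR (K := fun p : Metric.sphere (0 : V3) 1 × V3 => κs p.2)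
    (by fun_prop) hC hK1b
  have hT2 := k2r_ref_ok1_triple1 hΘ₁ hI₁ hR
    (K := fun p : Metric.sphere (0 : V3) 1 × V3 =>
      Real.cos (2 * Real.pi * ε * (p.1 : V3) 0) * κs p.2 - Real.sin (2 * Real.pi * ε * (p.1 : V3) 0) * κc p.2)
    hK2c hC2 hK2b
  have hTc := k2r_ref_ok1_triple1 hΘ₁ hI₁ hR (K := fun p : Metric.sphere (0 : V3) 1 × V3 => κc p.2)
    (by fun_prop) hC (fun p => hκcb p.2)
  have hG1i : Integrable (fun v : V3 => Θ₁ R v * ∫ p : Metric.sphere (0 : V3) 1 × V3,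
      max ⟪v - p.2, (p.1 : V3)⟫_ℝ 0 * globalMaxwellian p.2 * κs (p.2 + ⟪v - p.2, (p.1 : V3)⟫_ℝ • (p.1 : V3))
      ∂((sphereMeasure : Measure (Metric.sphere (0 : V3) 1)).prod volume)) := hT1.1
  have hG2i : Integrable (fun v : V3 => Θ₁ R v * ∫ p : Metric.sphere (0 : V3) 1 × V3,
      max ⟪v - p.2, (p.1 : V3)⟫_ℝ 0 * globalMaxwellian p.2 *
        (Real.cos (2 * Real.pi * ε * (p.1 : V3) 0) * κs (p.2 + ⟪v - p.2, (p.1 : V3)⟫_ℝ • (p.1 : V3)) -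
          Real.sin (2 * Real.pi * ε * (p.1 : V3) 0) * κc (p.2 + ⟪v - p.2, (p.1 : V3)⟫_ℝ • (p.1 : V3)))
      ∂((sphereMeasure : Measure (Metric.sphere (0 : V3) 1)).prod volume)) := hT2.1
  obtain ⟨hT3i, -⟩ := k2r_ref_ok1_loss_facts hΘ₁ hR hκsc hκsb
  obtain ⟨hG4i, hT4⟩ := k2r_ref_ok1_exchange_bound hΘ₁ hR
    (G := fun p : Metric.sphere (0 : V3) 1 × V3 =>
      Real.cos (2 * Real.pi * ε * (p.1 : V3) 0) * κs p.2 - Real.sin (2 * Real.pi * ε * (p.1 : V3) 0) * κc p.2)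
    hK2c hC hK2b
  obtain ⟨-, -, eAS⟩ := k2r_ref_ok1_dominated1 hΘ₀ hI₀ hI₁ hR hκsc.measurable hκsb
  -- the sphere sections `a_s(ω) = ∫ κ_s I₁`, `a_c(ω) = ∫ κ_c I₁` and the scalar quantities
  obtain ⟨aS, haS⟩ : ∃ aS : Metric.sphere (0 : V3) 1 → ℝ, ∀ ω, aS ω = ∫ U : V3, κs U * I₁ R U ω := ⟨_, fun _ => rfl⟩
  obtain ⟨aC, haC⟩ : ∃ aC : Metric.sphere (0 : V3) 1 → ℝ, ∀ ω, aC ω = ∫ U : V3, κc U * I₁ R U ω := ⟨_, fun _ => rfl⟩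
  have haSf : aS = fun ω : Metric.sphere (0 : V3) 1 => ∫ U : V3, κs U * I₁ R U ω := funext haS
  have haCf : aC = fun ω : Metric.sphere (0 : V3) 1 => ∫ U : V3, κc U * I₁ R U ω := funext haC
  have haSi : Integrable aS (sphereMeasure : Measure (Metric.sphere (0 : V3) 1)) := by rw [haSf]; exact hT1.2.1
  have haCi : Integrable aC (sphereMeasure : Measure (Metric.sphere (0 : V3) 1)) := by rw [haCf]; exact hTc.2.1
  obtain ⟨AS, hAS⟩ : ∃ AS : ℝ, AS = ∫ U : V3, κs U * ∫ ω : Metric.sphere (0 : V3) 1, I₁ R U ω ∂sphereMeasure :=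
    ⟨_, rfl⟩
  have eaS : ∫ ω : Metric.sphere (0 : V3) 1, aS ω ∂sphereMeasure = AS := by
    rw [hAS, ← eAS, haSf]
  obtain ⟨Ecw, hEcw⟩ : ∃ Ecw : ℝ, Ecw = ∫ ω : Metric.sphere (0 : V3) 1,
      (Real.cos (2 * Real.pi * ε * (ω : V3) 0) - 1) * aS ω ∂sphereMeasure := ⟨_, rfl⟩
  obtain ⟨Esw, hEsw⟩ : ∃ Esw : ℝ, Esw = ∫ ω : Metric.sphere (0 : V3) 1,
      Real.sin (2 * Real.pi * ε * (ω : V3) 0) * aC ω ∂sphereMeasure := ⟨_, rfl⟩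
  -- the delocalised gain: `∫ Θ₁ G₂ = AS + Ecw − Esw`, and the local gain `∫ Θ₁ G₁ = AS`
  have hdC : ∀ ω : Metric.sphere (0 : V3) 1, Integrable (fun U : V3 => κc U * I₁ R U ω) := fun ω =>
    (k2r_ref_ok1_dual1 hΘ₁ hI₁ hR ω hκcc.measurable hκcb).1
  have hdS : ∀ ω : Metric.sphere (0 : V3) 1, Integrable (fun U : V3 => κs U * I₁ R U ω) := fun ω =>
    (k2r_ref_ok1_dual1 hΘ₁ hI₁ hR ω hκsc.measurable hκsb).1
  have einner : ∀ ω : Metric.sphere (0 : V3) 1, (∫ U : V3,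
      (Real.cos (2 * Real.pi * ε * (ω : V3) 0) * κs U - Real.sin (2 * Real.pi * ε * (ω : V3) 0) * κc U) * I₁ R U ω) =
      aS ω + (Real.cos (2 * Real.pi * ε * (ω : V3) 0) - 1) * aS ω - Real.sin (2 * Real.pi * ε * (ω : V3) 0) * aC ω := by
    intro ω
    have e : ∀ U : V3, (Real.cos (2 * Real.pi * ε * (ω : V3) 0) * κs U -
        Real.sin (2 * Real.pi * ε * (ω : V3) 0) * κc U) * I₁ R U ω =
        Real.cos (2 * Real.pi * ε * (ω : V3) 0) * (κs U * I₁ R U ω) -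
          Real.sin (2 * Real.pi * ε * (ω : V3) 0) * (κc U * I₁ R U ω) := fun U => by ring
    simp_rw [e]
    rw [integral_sub ((hdS ω).const_mul _) ((hdC ω).const_mul _), integral_const_mul, integral_const_mul, haS, haC]
    ring
  have hcwI : Integrable (fun ω : Metric.sphere (0 : V3) 1 => (Real.cos (2 * Real.pi * ε * (ω : V3) 0) - 1) * aS ω)
      sphereMeasure :=
    haSi.bdd_mul (c := 2) (Continuous.aestronglyMeasurable (by fun_prop)) (Eventually.of_forall fun ω => by
      rw [Real.norm_eq_abs]
      refine (abs_sub _ _).trans ?_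
      rw [abs_one]
      linarith only [Real.abs_cos_le_one (2 * Real.pi * ε * (ω : V3) 0)])
  have hswI : Integrable (fun ω : Metric.sphere (0 : V3) 1 => Real.sin (2 * Real.pi * ε * (ω : V3) 0) * aC ω)
      sphereMeasure :=
    haCi.bdd_mul (c := 1) (Continuous.aestronglyMeasurable (by fun_prop)) (Eventually.of_forall fun ω => by
      rw [Real.norm_eq_abs]; exact Real.abs_sin_le_one _)
  have hI12 : Integrable (fun ω : Metric.sphere (0 : V3) 1 =>
      aS ω + (Real.cos (2 * Real.pi * ε * (ω : V3) 0) - 1) * aS ω) sphereMeasure := haSi.add hcwI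
  have eG2 : (∫ v : V3, Θ₁ R v * ∫ p : Metric.sphere (0 : V3) 1 × V3,
      max ⟪v - p.2, (p.1 : V3)⟫_ℝ 0 * globalMaxwellian p.2 *
        (Real.cos (2 * Real.pi * ε * (p.1 : V3) 0) * κs (p.2 + ⟪v - p.2, (p.1 : V3)⟫_ℝ • (p.1 : V3)) -
          Real.sin (2 * Real.pi * ε * (p.1 : V3) 0) * κc (p.2 + ⟪v - p.2, (p.1 : V3)⟫_ℝ • (p.1 : V3)))
      ∂((sphereMeasure : Measure (Metric.sphere (0 : V3) 1)).prod volume)) = AS + Ecw - Esw := by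
    refine hT2.2.2.trans ?_
    rw [integral_congr_ae (Eventually.of_forall einner), integral_sub hI12 hswI, integral_add haSi hcwI, eaS, hEcw,
      hEsw]
  have eG1 : (∫ v : V3, Θ₁ R v * ∫ p : Metric.sphere (0 : V3) 1 × V3,
      max ⟪v - p.2, (p.1 : V3)⟫_ℝ 0 * globalMaxwellian p.2 * κs (p.2 + ⟪v - p.2, (p.1 : V3)⟫_ℝ • (p.1 : V3))
      ∂((sphereMeasure : Measure (Metric.sphere (0 : V3) 1)).prod volume)) = AS := by
    refine hT1.2.2.trans ?_
    rw [hAS, ← eAS]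
  -- the `x`-integral first, then Fubini on `𝕋³ × ℝ³`
  obtain ⟨T, hT⟩ : ∃ T : ℝ, T = ∫ U : V3, Θ₁ R U * (collisionFrequency U * κs U) := ⟨_, rfl⟩
  obtain ⟨K0, hK0⟩ : ∃ K0 : ℝ, K0 = ∫ U : V3, ((1 + ‖U‖ ^ 2) ^ 3)⁻¹ * Real.exp (-‖U‖ ^ 2 / R) * U 0 * κs U :=
    ⟨_, rfl⟩
  obtain ⟨T4, hT4d⟩ : ∃ T4 : ℝ, T4 = ∫ v : V3, Θ₁ R v * ∫ p : Metric.sphere (0 : V3) 1 × V3,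
      max ⟪v - p.2, (p.1 : V3)⟫_ℝ 0 * globalMaxwellian p.2 *
        (Real.cos (2 * Real.pi * ε * (p.1 : V3) 0) * κs p.2 - Real.sin (2 * Real.pi * ε * (p.1 : V3) 0) * κc p.2)
      ∂((sphereMeasure : Measure (Metric.sphere (0 : V3) 1)).prod volume) := ⟨_, rfl⟩
  have e2 : ∀ v : V3, (∫ x : UnitAddTorus (Fin 3), (Real.sqrt (‖v‖ ^ 2) * ((1 + ‖v‖ ^ 2) ^ 4)⁻¹ *
      Real.exp (-‖v‖ ^ 2 / R) * v 0) * ((z * Torus.sinCoord 0 x) * Lκ x v)) =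
      z * (Y₀ * ρ₀) * (Θ₁ R v * (∫ p : Metric.sphere (0 : V3) 1 × V3,
          max ⟪v - p.2, (p.1 : V3)⟫_ℝ 0 * globalMaxwellian p.2 * κs (p.2 + ⟪v - p.2, (p.1 : V3)⟫_ℝ • (p.1 : V3))
          ∂((sphereMeasure : Measure (Metric.sphere (0 : V3) 1)).prod volume)) +
        Θ₁ R v * (∫ p : Metric.sphere (0 : V3) 1 × V3,
          max ⟪v - p.2, (p.1 : V3)⟫_ℝ 0 * globalMaxwellian p.2 *
            (Real.cos (2 * Real.pi * ε * (p.1 : V3) 0) * κs (p.2 + ⟪v - p.2, (p.1 : V3)⟫_ℝ • (p.1 : V3)) -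
              Real.sin (2 * Real.pi * ε * (p.1 : V3) 0) * κc (p.2 + ⟪v - p.2, (p.1 : V3)⟫_ℝ • (p.1 : V3)))
          ∂((sphereMeasure : Measure (Metric.sphere (0 : V3) 1)).prod volume)) -
        Θ₁ R v * (collisionFrequency v * κs v) -
        Θ₁ R v * ∫ p : Metric.sphere (0 : V3) 1 × V3,
          max ⟪v - p.2, (p.1 : V3)⟫_ℝ 0 * globalMaxwellian p.2 *
            (Real.cos (2 * Real.pi * ε * (p.1 : V3) 0) * κs p.2 - Real.sin (2 * Real.pi * ε * (p.1 : V3) 0) * κc p.2)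
          ∂((sphereMeasure : Measure (Metric.sphere (0 : V3) 1)).prod volume)) := by
    intro v
    have e : ∀ x : UnitAddTorus (Fin 3), (Real.sqrt (‖v‖ ^ 2) * ((1 + ‖v‖ ^ 2) ^ 4)⁻¹ *
        Real.exp (-‖v‖ ^ 2 / R) * v 0) * ((z * Torus.sinCoord 0 x) * Lκ x v) =
        (z * Θ₁ R v) * (Torus.sinCoord 0 x * Lκ x v) := fun x => by rw [hΘ₁]; ring
    simp_rw [e]
    rw [integral_const_mul, k2r_ref_ok1_x_integral hκ hκb hκs hκc Lκ hLκ v]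
    ring
  have hS12 : Integrable (fun v : V3 => Θ₁ R v * (∫ p : Metric.sphere (0 : V3) 1 × V3,
          max ⟪v - p.2, (p.1 : V3)⟫_ℝ 0 * globalMaxwellian p.2 * κs (p.2 + ⟪v - p.2, (p.1 : V3)⟫_ℝ • (p.1 : V3))
          ∂((sphereMeasure : Measure (Metric.sphere (0 : V3) 1)).prod volume)) +
        Θ₁ R v * (∫ p : Metric.sphere (0 : V3) 1 × V3,
          max ⟪v - p.2, (p.1 : V3)⟫_ℝ 0 * globalMaxwellian p.2 *
            (Real.cos (2 * Real.pi * ε * (p.1 : V3) 0) * κs (p.2 + ⟪v - p.2, (p.1 : V3)⟫_ℝ • (p.1 : V3)) -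
              Real.sin (2 * Real.pi * ε * (p.1 : V3) 0) * κc (p.2 + ⟪v - p.2, (p.1 : V3)⟫_ℝ • (p.1 : V3)))
          ∂((sphereMeasure : Measure (Metric.sphere (0 : V3) 1)).prod volume))) := hG1i.add hG2i
  have hS123 : Integrable (fun v : V3 => Θ₁ R v * (∫ p : Metric.sphere (0 : V3) 1 × V3,
          max ⟪v - p.2, (p.1 : V3)⟫_ℝ 0 * globalMaxwellian p.2 * κs (p.2 + ⟪v - p.2, (p.1 : V3)⟫_ℝ • (p.1 : V3))
          ∂((sphereMeasure : Measure (Metric.sphere (0 : V3) 1)).prod volume)) +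
        Θ₁ R v * (∫ p : Metric.sphere (0 : V3) 1 × V3,
          max ⟪v - p.2, (p.1 : V3)⟫_ℝ 0 * globalMaxwellian p.2 *
            (Real.cos (2 * Real.pi * ε * (p.1 : V3) 0) * κs (p.2 + ⟪v - p.2, (p.1 : V3)⟫_ℝ • (p.1 : V3)) -
              Real.sin (2 * Real.pi * ε * (p.1 : V3) 0) * κc (p.2 + ⟪v - p.2, (p.1 : V3)⟫_ℝ • (p.1 : V3)))
          ∂((sphereMeasure : Measure (Metric.sphere (0 : V3) 1)).prod volume)) -
        Θ₁ R v * (collisionFrequency v * κs v)) := hS12.sub hT3i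
  have e3 : (∫ x : UnitAddTorus (Fin 3), ∫ v : V3, (Real.sqrt (‖v‖ ^ 2) * ((1 + ‖v‖ ^ 2) ^ 4)⁻¹ *
      Real.exp (-‖v‖ ^ 2 / R) * v 0) * ((z * Torus.sinCoord 0 x) * Lκ x v)) =
      z * (Y₀ * ρ₀) * (AS + (AS + Ecw - Esw) - T - T4) := by
    rw [integral_integral_swap hInt, integral_congr_ae (Eventually.of_forall e2), integral_const_mul,
      integral_sub hS123 hG4i, integral_sub hS12 hT3i, integral_add hG1i hG2i, eG1, eG2, hT, hT4d]
  -- the first-moment functional and the contraction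
  have eK0 : (∫ x : UnitAddTorus (Fin 3), ∫ v : V3, ((1 + ‖v‖ ^ 2) ^ 3)⁻¹ * Real.exp (-‖v‖ ^ 2 / R) * v 0 *
      Torus.sinCoord 0 x * κ x v) = K0 := by
    rw [hK0]
    exact (k2r_ref_ok1_k0_fubini hκ hκb hκs hR).2
  obtain ⟨hK1i, hK1b⟩ := hM₁ R hR
  have hKB : ∀ U : V3, ∫ ω : Metric.sphere (0 : V3) 1, I₁ R U ω ∂sphereMeasure = U 0 *
      (fun E : ℝ => Real.pi * ∫ t in (-1 : ℝ)..1, t ^ 2 * Real.exp (-(E * (1 - t ^ 2)) / 2) *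
        (∫ b, max (Real.sqrt E * t - b) 0 * (Real.exp (-b ^ 2 / 2) / Real.sqrt (2 * Real.pi))) *
        ∫ E' in Set.Ioi (E * t ^ 2), Real.sqrt E' * ((1 + E') ^ 4)⁻¹ * Real.exp (-E' / R)) (‖U‖ ^ 2) := by
    intro U
    have h := ((stub_kernelBridge stub_sphereCalculus.1 R hR).1 U).2.2.2.2
    have e : (fun ω : Metric.sphere (0 : V3) 1 => I₁ R U ω) = fun ω : Metric.sphere (0 : V3) 1 =>
        ((ω : V3) 0 * ⟪U, (ω : V3)⟫_ℝ * ((1 / 2 : ℝ) * Real.exp (-(‖U‖ ^ 2 - ⟪U, (ω : V3)⟫_ℝ ^ 2) / 2) *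
          (∫ b, max (⟪U, (ω : V3)⟫_ℝ - b) 0 * (Real.exp (-b ^ 2 / 2) / Real.sqrt (2 * π))) *
          ∫ E in Ioi (⟪U, (ω : V3)⟫_ℝ ^ 2), Real.sqrt E * ((1 + E) ^ 4)⁻¹ * Real.exp (-E / R))) :=
      funext fun ω => hI₁ R U ω
    rw [e]
    exact h
  have hgm : Measurable fun E : ℝ => ∫ t in (-1 : ℝ)..1, t ^ 2 * Real.exp (-(E * (1 - t ^ 2)) / 2) *
      (fun a : ℝ => ∫ b, max (a - b) 0 * (Real.exp (-b ^ 2 / 2) / Real.sqrt (2 * Real.pi))) (Real.sqrt E * t) *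
      ∫ y in Set.Ioi (E * t ^ 2), Real.sqrt y * ((1 + y) ^ 4)⁻¹ * Real.exp (-y / R) :=
    k2r_ref_K1_measurable_gain hhc hR0
  have hnm : Measurable fun E : ℝ => collisionFrequency (Real.sqrt E • (EuclideanSpace.single 0 1 : V3)) :=
    hcfm.comp (by fun_prop)
  have hsm : Measurable Real.sqrt := Real.continuous_sqrt.measurable
  have hctr := k2r_ref_ok1_contraction hΘ₀ hΘ₁ hI₀ hI₁ hR hκsc hκsb hKB
    (e₁ := fun E : ℝ => 2 * (Real.pi * ∫ t in (-1 : ℝ)..1, t ^ 2 * Real.exp (-(E * (1 - t ^ 2)) / 2) *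
        (∫ b, max (Real.sqrt E * t - b) 0 * (Real.exp (-b ^ 2 / 2) / Real.sqrt (2 * Real.pi))) *
        ∫ E' in Set.Ioi (E * t ^ 2), Real.sqrt E' * ((1 + E') ^ 4)⁻¹ * Real.exp (-E' / R)) -
      collisionFrequency (Real.sqrt E • (EuclideanSpace.single 0 1 : V3)) *
        (Real.sqrt E * ((1 + E) ^ 4)⁻¹ * Real.exp (-E / R)) +
      Real.pi / 5 * Real.sqrt E * (Real.sqrt E * ((1 + E) ^ 4)⁻¹ * Real.exp (-E / R)))
    (((hgm.const_mul Real.pi).const_mul 2 |>.sub (hnm.mul (by fun_prop))).add (by fun_prop)) (fun _ => rfl) hK1i hK1b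
  rw [← hAS, ← hT, ← hK0] at hctr
  -- the budgets
  obtain ⟨hbI, -, hBle⟩ := k2r_ref_ok1_B_le hΘ₀ hI₀ hR
  have hω1 : ∀ ω : Metric.sphere (0 : V3) 1, |(ω : V3) 0| ≤ 1 := fun ω => by
    have h := PiLp.norm_apply_le (ω : V3) 0
    rwa [Real.norm_eq_abs, norm_eq_of_mem_sphere ω] at h
  have hslice : ∀ {F : V3 → ℝ} {CF : ℝ}, (∀ U, |F U| ≤ CF * (1 + ‖U‖ ^ 2)) → ∀ ω : Metric.sphere (0 : V3) 1,
      |∫ U : V3, F U * I₁ R U ω| ≤ CF * ∫ U : V3, (1 + ‖U‖ ^ 2) * I₀ R U ω := by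
    intro F CF hCF ω
    have h := norm_integral_le_of_norm_le ((k2r_ref_ok0_Q_le hΘ₀ hI₀ hR ω).1.const_mul CF)
      (f := fun U : V3 => F U * I₁ R U ω) (Eventually.of_forall fun U => by
        obtain ⟨-, h1⟩ := k2r_ref_ok1_abs_I1_le hI₀ hI₁ hR0 U ω (hω1 ω)
        rw [Real.norm_eq_abs, abs_mul]
        calc |F U| * |I₁ R U ω| ≤ CF * (1 + ‖U‖ ^ 2) * I₀ R U ω :=
              mul_le_mul (hCF U) h1 (abs_nonneg _) ((abs_nonneg _).trans (hCF U))
          _ = CF * ((1 + ‖U‖ ^ 2) * I₀ R U ω) := by ring)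
    rwa [integral_const_mul, Real.norm_eq_abs] at h
  have hcw : |Ecw| ≤ (2 * Real.pi * ε) ^ 2 / 2 * C *
      ∫ ω : Metric.sphere (0 : V3) 1, (∫ U : V3, (1 + ‖U‖ ^ 2) * I₀ R U ω) ∂sphereMeasure := by
    have h := norm_integral_le_of_norm_le (hbI.const_mul ((2 * Real.pi * ε) ^ 2 / 2 * C))
      (f := fun ω : Metric.sphere (0 : V3) 1 => (Real.cos (2 * Real.pi * ε * (ω : V3) 0) - 1) * aS ω)
      (Eventually.of_forall fun ω => by
        have hy : |Real.cos (2 * Real.pi * ε * (ω : V3) 0) - 1| ≤ (2 * Real.pi * ε) ^ 2 / 2 := by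
          have h0 := Real.cos_le_one (2 * Real.pi * ε * (ω : V3) 0)
          have h1 := Real.one_sub_sq_div_two_le_cos (x := 2 * Real.pi * ε * (ω : V3) 0)
          have h3 : ((ω : V3) 0) ^ 2 ≤ 1 := by
            have h4 := hω1 ω
            rw [← sq_abs]
            nlinarith only [abs_nonneg ((ω : V3) 0), h4]
          have h2 : (2 * Real.pi * ε * (ω : V3) 0) ^ 2 ≤ (2 * Real.pi * ε) ^ 2 := by
            rw [mul_pow]
            nlinarith only [sq_nonneg (2 * Real.pi * ε), h3]
          rw [abs_sub_comm, abs_of_nonneg (by linarith only [h0])]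
          linarith only [h1, h2]
        rw [Real.norm_eq_abs, abs_mul, haS]
        calc |Real.cos (2 * Real.pi * ε * (ω : V3) 0) - 1| * |∫ U : V3, κs U * I₁ R U ω|
            ≤ (2 * Real.pi * ε) ^ 2 / 2 * (C * ∫ U : V3, (1 + ‖U‖ ^ 2) * I₀ R U ω) :=
              mul_le_mul hy (hslice hκsb ω) (abs_nonneg _) (by positivity)
          _ = _ := by ring)
    rwa [integral_const_mul, Real.norm_eq_abs, ← hEcw] at h
  have hsw : |Esw| ≤ (2 * Real.pi * ε) * C *
      ∫ ω : Metric.sphere (0 : V3) 1, (∫ U : V3, (1 + ‖U‖ ^ 2) * I₀ R U ω) ∂sphereMeasure := by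
    have h := norm_integral_le_of_norm_le (hbI.const_mul ((2 * Real.pi * ε) * C))
      (f := fun ω : Metric.sphere (0 : V3) 1 => Real.sin (2 * Real.pi * ε * (ω : V3) 0) * aC ω)
      (Eventually.of_forall fun ω => by
        have hy : |Real.sin (2 * Real.pi * ε * (ω : V3) 0)| ≤ 2 * Real.pi * ε := by
          refine Real.abs_sin_le_abs.trans ?_
          rw [abs_mul, abs_of_nonneg hk0]
          exact mul_le_of_le_one_right hk0 (hω1 ω)
        rw [Real.norm_eq_abs, abs_mul, haC]
        calc |Real.sin (2 * Real.pi * ε * (ω : V3) 0)| * |∫ U : V3, κc U * I₁ R U ω|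
            ≤ (2 * Real.pi * ε) * (C * ∫ U : V3, (1 + ‖U‖ ^ 2) * I₀ R U ω) :=
              mul_le_mul hy (hslice hκcb ω) (abs_nonneg _) (by positivity)
          _ = _ := by ring)
    rwa [integral_const_mul, Real.norm_eq_abs, ← hEsw] at h
  have hJ0 : 0 ≤ ∫ E in Set.Ioi (0 : ℝ), E ^ 2 * (((1 + E) ^ 3)⁻¹ * Real.exp (-E / R)) :=
    le_trans (div_nonneg (Real.log_nonneg hR) (by norm_num)) (k2r_ref_J_facts hR).2.2.1
  -- conclusion
  rw [e3, eK0, show z * (Y₀ * ρ₀) * (AS + (AS + Ecw - Esw) - T - T4) - -(z * (Real.pi / 5 * (Y₀ * ρ₀)) * K0) =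
    z * (Y₀ * ρ₀) * ((2 * AS - T + Real.pi / 5 * K0) + Ecw - Esw - T4) by ring]
  exact k2r_ref_ok1_arith (mul_pos hY₀ hρ₀) hC hk0 hJ0 hBle (le_max_left _ _) (le_max_right _ _) hcw hsw hctr
    (hT4d ▸ hT4)

end Summit.AtomisticToContinuum.HydrodynamicLimit.Theorems.EnskogAdjointDuality
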